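import Literature.MathematicalPhysics.QuantumFieldTheory.Balaban1983to89.B9Eq349ConjugatedGreenLettersTwoBackgrounds

/-!
# `Balaban1983to89.B9Eq349ConjugatedProjectionDifferenceLettersTwoBackgrounds` — T. Bałaban, *Propagators for lattice gauge theories in a background
# field*, Commun. Math. Phys. **99** (1985) 389–434 [Balaban1985BackgroundPropagators] (3.21)∕(3.25) p. 394, (3.49) p. 399, Thm 3.11 p. 416: **THE
# CONJUGATED PROJECTION WORD `P_κ = A_κc_κB_κ` (`A_κ = G_κQ′_κ`, `B_κ = Q_κG_κ`, `c_κ` the conjugated inverse Gram operator, `B_κA_κc_κ = 1 = c_κB_κA_κ`)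
# AT TWO BACKGROUNDS — `‖P_κ(V)x − P_κ(U)x‖ ≤ ρ₂·‖x‖` with `ρ₂` LINEAR in the four conjugated two-background letters `b_D, b_{D′}, b_Q, b_{Q′}`**: §1 the
# word algebra for ANY three-factor words `A_ic_iB_i` with an inverse middle (`c₂ − c₁ = c₂(B₁A₁ − B₂A₂)c₁`, then the product rule), §2 the instance in the
# letters of `B9Eq349ConjugatedGreenLettersTwoBackgrounds` (I-9: `‖A_{κ,2} − A_{κ,1}‖`, `‖B_{κ,2} − B_{κ,1}‖`) with the conjugated Gram bound `‖c_{κ,i}‖ ≤ C_c`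
# displayed (on the chain: `C_c = 2∕κ₁`, ne9-leaf-03's `B9Eq349ConjugatedQGGQInvLetters.norm_ck_le`) — the two-background twin of ne9-leaf-03's
# `B9Eq349ConjugatedProjectionDifferenceLetters.norm_Pk_sub_P_le` (`P_κ − P = A_κ(T_κ − T) + (A_κ − A)T`)

statement-level skeleton of published theorems with citation tags; proofs where landed; nothing here is a claim about the Yang–Mills mass gap

CITATION HEADER (lean-in-tree rule 2026-08-18).  Audit cell `pub-balaban`, sub-cell `t4`, NE9 crux team (2): LEAF PROVER 01 (`b2b-balaban-t4-ne9-formalise-leaf-01`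
gen 90), I-10 = the THIRD brick of the last displayed conjugated two-background letter `δ_R` of the N52 road (α) END (ne9-leaf-04 g81's located plan (M+)):
since `1 − R(X) = P(X) = G′Q̃′†(Q̃′G′²Q̃′†)⁻¹Q̃′G′` at `X` ((3.25); ne9-leaf-06's `B9Eq349ConjugatedProjectionChain.one_sub_RofU_apply_eq`) and the conjugation
factors through the word (`S P S⁻¹ = (SG′Q̃′†S_G⁻¹)(S_G c S_G⁻¹)(S_G Q̃′G′S⁻¹)`), the conjugated two-background letter of `R` is the two-background difference
of the conjugated WORD — this file, abstractly; the tower instance (with I-8's `b_Q`, gen 88's `b_D` and leaf-03's `C_c = 2∕κ₁`) is the next brick.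
TEMPLATES CREDITED: ne9-leaf-03's `B9Eq349ConjugatedProjectionDifferenceLetters` (the word and its bookkeeping), ne9-leaf-05's `B9Eq349ConjugatedGreenLetters`.

WHAT IS PROVED (sorry-free; 0 `def`; [folklore] normed-space bookkeeping; nothing of [B9] asserted).
* §1 (any linear `A_i : F → S`, `B_i : S → F`, `c_i : F → F` with `B₁A₁c₁ = 1`, `c₂B₂A₂ = 1` and size ∕ difference letters `n_A, n_B, n_c, d_A, d_B`):
  `norm_BA_sub_BA_le` (`‖B₁A₁ − B₂A₂‖ ≤ d_Bn_A + n_Bd_A`), **`norm_c_sub_c_le`** (`‖c₂ − c₁‖ ≤ n_c²(d_Bn_A + n_Bd_A)` — the Gram resolvent identity),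
  **`norm_word_sub_word_le`** (`‖A₂c₂B₂ − A₁c₁B₁‖ ≤ d_An_cn_B + n_An_c²(d_Bn_A + n_Bd_A)n_B + n_An_cd_B`).
* §2 **`norm_Pk_sub_Pk_le`** — for the two conjugated families of I-9 with `‖c_{κ,i}‖ ≤ C_c`:
  `‖G_{κ,2}Q′_{κ,2}c_{κ,2}Q_{κ,2}G_{κ,2}x − G_{κ,1}Q′_{κ,1}c_{κ,1}Q_{κ,1}G_{κ,1}x‖ ≤ ρ₂‖x‖`, `ρ₂ = σC_cn + n·C_c²·2σn·n + nC_cσ` with `n = (4∕γ)(C_Q + 1)` and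
  `σ = (4∕γ)(b_Q + b_{Q′})∕… ` the common bound `max`-free sum of I-9's two seams (`σ = (4∕γ)b_{Q′} + b_Q(4∕γ) + 2(C_Q+1)(4∕γ)²(2b_{D′} + (1+β)b_D + a(C_Q+1)(b_Q + b_{Q′}))`,
  which dominates both) — LINEAR in `b_D, b_{D′}, b_Q, b_{Q′}`.
HONEST SCOPE.  Symbolic: no lattice, no multiplier, no number; `γ`, `C_Q`, `C_c` (KAPPA1 load-bearing on the chain) displayed; ONE brick of a located plan;
NOT NE9; «NE9 ⇐ the named binders»; NE9 NOT PRINTED ∕ NOT PROVED; NOT summit progress (cell pub-balaban: row NE9 WALLED ON A MODEL (O-NE9-1; #5 UNRULED);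
spine PROVED 0∕9; rung (B)+1 finite T⁴ — NOT infinite volume, NOT mass gap, NOT BetaPertH, NOT Clay; HONEST DEPENDENCY: continuum YM on T⁴ ⇐ BetaPertH ∧
nine spine estimates (0/9 proved); BetaPertH ⇐ (D1) ∧ (D4) ∧ CAP+tail; G-an2-4 gates asym, D1 and NE2/3/4).  NEW file importing I-9 only; nothing modified.
Net new unproved facts: 0.
-/

namespace Literature.MathematicalPhysics.QuantumFieldTheory.Balaban1983to89.B9Eq349ConjugatedProjectionDifferenceLettersTwoBackgrounds

open scoped InnerProductSpace
open B9Eq349ConjugatedGreenLetters (norm_Gk_le norm_Qk_le norm_Qk'_le)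
open B9Eq349ConjugatedGreenLettersTwoBackgrounds (norm_Gk_Qk'_sub_Gk_Qk'_le norm_Qk_Gk_sub_Qk_Gk_le)

variable {𝕜 : Type*} [RCLike 𝕜]

/-! ## §1 The word algebra: three factors with an inverse middle, at two backgrounds -/

section Word

variable {S F : Type*} [NormedAddCommGroup S] [NormedSpace 𝕜 S] [NormedAddCommGroup F] [NormedSpace 𝕜 F]
  (A₁ A₂ : F →ₗ[𝕜] S) (B₁ B₂ : S →ₗ[𝕜] F) (c₁ c₂ : F →ₗ[𝕜] F) {nA nB nc dA dB : ℝ}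
  (hnA : 0 ≤ nA) (hnB : 0 ≤ nB) (hnc : 0 ≤ nc) (hdA : 0 ≤ dA) (hdB : 0 ≤ dB)
  (hA₁ : ∀ h, ‖A₁ h‖ ≤ nA * ‖h‖) (hB₂ : ∀ x, ‖B₂ x‖ ≤ nB * ‖x‖) (hc₁ : ∀ v, ‖c₁ v‖ ≤ nc * ‖v‖) (hc₂ : ∀ v, ‖c₂ v‖ ≤ nc * ‖v‖)
  (hA : ∀ h, ‖A₂ h - A₁ h‖ ≤ dA * ‖h‖) (hB : ∀ x, ‖B₂ x - B₁ x‖ ≤ dB * ‖x‖)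
  (hBAc₁ : ∀ v, B₁ (A₁ (c₁ v)) = v) (hcBA₂ : ∀ h, c₂ (B₂ (A₂ h)) = h)

include hnB hdB hA₁ hB₂ hA hB in
/-- `‖B₁A₁w − B₂A₂w‖ ≤ (d_Bn_A + n_Bd_A)‖w‖`. [folklore] [cite: Balaban1985BackgroundPropagators, (3.25) p.394, (3.49) p.399] -/
theorem norm_BA_sub_BA_le (w : F) : ‖B₁ (A₁ w) - B₂ (A₂ w)‖ ≤ (dB * nA + nB * dA) * ‖w‖ := by
  have e : B₁ (A₁ w) - B₂ (A₂ w) = -(B₂ (A₁ w) - B₁ (A₁ w)) - B₂ (A₂ w - A₁ w) := by rw [map_sub]; abel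
  rw [e]
  calc ‖-(B₂ (A₁ w) - B₁ (A₁ w)) - B₂ (A₂ w - A₁ w)‖ ≤ ‖B₂ (A₁ w) - B₁ (A₁ w)‖ + ‖B₂ (A₂ w - A₁ w)‖ := by
        refine (norm_sub_le _ _).trans ?_; rw [norm_neg]
    _ ≤ dB * (nA * ‖w‖) + nB * (dA * ‖w‖) :=
        add_le_add ((hB _).trans (mul_le_mul_of_nonneg_left (hA₁ w) hdB)) ((hB₂ _).trans (mul_le_mul_of_nonneg_left (hA w) hnB))
    _ = (dB * nA + nB * dA) * ‖w‖ := by ring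

include hnA hnB hnc hdA hdB hA₁ hB₂ hc₁ hc₂ hA hB hBAc₁ hcBA₂ in
/-- **THE GRAM RESOLVENT IDENTITY AT TWO BACKGROUNDS**: `c₂ − c₁ = c₂(B₁A₁ − B₂A₂)c₁` (`B₁A₁c₁ = 1`, `c₂B₂A₂ = 1`) ⟹ `‖c₂v − c₁v‖ ≤ n_c²(d_Bn_A + n_Bd_A)‖v‖`.
[folklore] [cite: Balaban1985BackgroundPropagators, (3.25) p.394, Thm 3.11 p.416, (3.49) p.399] -/
theorem norm_c_sub_c_le (v : F) : ‖c₂ v - c₁ v‖ ≤ nc * (dB * nA + nB * dA) * nc * ‖v‖ := by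
  have e : c₂ v - c₁ v = c₂ (B₁ (A₁ (c₁ v)) - B₂ (A₂ (c₁ v))) := by rw [map_sub, hBAc₁, hcBA₂]
  rw [e]
  calc ‖c₂ (B₁ (A₁ (c₁ v)) - B₂ (A₂ (c₁ v)))‖ ≤ nc * ‖B₁ (A₁ (c₁ v)) - B₂ (A₂ (c₁ v))‖ := hc₂ _
    _ ≤ nc * ((dB * nA + nB * dA) * (nc * ‖v‖)) := mul_le_mul_of_nonneg_left
        ((norm_BA_sub_BA_le A₁ A₂ B₁ B₂ hnB hdB hA₁ hB₂ hA hB _).trans (mul_le_mul_of_nonneg_left (hc₁ v) (by positivity))) hnc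
    _ = _ := by ring

include hnA hnB hnc hdA hdB hA₁ hB₂ hc₁ hc₂ hA hB hBAc₁ hcBA₂ in
/-- **THE WORD AT TWO BACKGROUNDS**: `A₂c₂B₂ − A₁c₁B₁ = (A₂ − A₁)c₂B₂ + A₁(c₂ − c₁)B₂ + A₁c₁(B₂ − B₁)` ⟹
`‖A₂c₂B₂x − A₁c₁B₁x‖ ≤ (d_An_cn_B + n_A·n_c²(d_Bn_A + n_Bd_A)·n_B + n_An_cd_B)‖x‖`. [folklore]
[cite: Balaban1985BackgroundPropagators, (3.21) p.394, (3.25) p.394, (3.49) p.399] -/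
theorem norm_word_sub_word_le (x : S) :
    ‖A₂ (c₂ (B₂ x)) - A₁ (c₁ (B₁ x))‖ ≤ (dA * nc * nB + nA * (nc * (dB * nA + nB * dA) * nc) * nB + nA * nc * dB) * ‖x‖ := by
  have e : A₂ (c₂ (B₂ x)) - A₁ (c₁ (B₁ x)) =
      (A₂ (c₂ (B₂ x)) - A₁ (c₂ (B₂ x))) + A₁ (c₂ (B₂ x) - c₁ (B₂ x)) + A₁ (c₁ (B₂ x - B₁ x)) := by
    simp only [map_sub]; abel
  rw [e]
  have t1 : ‖A₂ (c₂ (B₂ x)) - A₁ (c₂ (B₂ x))‖ ≤ dA * (nc * (nB * ‖x‖)) :=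
    (hA _).trans (mul_le_mul_of_nonneg_left ((hc₂ _).trans (mul_le_mul_of_nonneg_left (hB₂ x) hnc)) hdA)
  have t2 : ‖A₁ (c₂ (B₂ x) - c₁ (B₂ x))‖ ≤ nA * (nc * (dB * nA + nB * dA) * nc * (nB * ‖x‖)) :=
    (hA₁ _).trans (mul_le_mul_of_nonneg_left
      ((norm_c_sub_c_le A₁ A₂ B₁ B₂ c₁ c₂ hnA hnB hnc hdA hdB hA₁ hB₂ hc₁ hc₂ hA hB hBAc₁ hcBA₂ _).trans
        (mul_le_mul_of_nonneg_left (hB₂ x) (by positivity))) hnA)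
  have t3 : ‖A₁ (c₁ (B₂ x - B₁ x))‖ ≤ nA * (nc * (dB * ‖x‖)) :=
    (hA₁ _).trans (mul_le_mul_of_nonneg_left ((hc₁ _).trans (mul_le_mul_of_nonneg_left (hB x) hnc)) hnA)
  calc _ ≤ ‖A₂ (c₂ (B₂ x)) - A₁ (c₂ (B₂ x))‖ + ‖A₁ (c₂ (B₂ x) - c₁ (B₂ x))‖ + ‖A₁ (c₁ (B₂ x - B₁ x))‖ := norm_add₃_le
    _ ≤ dA * (nc * (nB * ‖x‖)) + nA * (nc * (dB * nA + nB * dA) * nc * (nB * ‖x‖)) + nA * (nc * (dB * ‖x‖)) := add_le_add_three t1 t2 t3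
    _ = _ := by ring

end Word

/-! ## §2 The instance in the letters of the two conjugated families -/

section Families

variable {S E F : Type*} [NormedAddCommGroup S] [InnerProductSpace 𝕜 S] [NormedAddCommGroup E] [InnerProductSpace 𝕜 E]
  [NormedAddCommGroup F] [InnerProductSpace 𝕜 F] [FiniteDimensional 𝕜 S] [FiniteDimensional 𝕜 E] [FiniteDimensional 𝕜 F]

variable (D₁ D₂ : S →ₗ[𝕜] E) (Q₁ Q₂ : S →ₗ[𝕜] F) (a γ CQ β : ℝ)
  (Dk₁ Dk₂ : S →ₗ[𝕜] E) (Dk₁' Dk₂' : E →ₗ[𝕜] S) (Qk₁ Qk₂ : S →ₗ[𝕜] F) (Qk₁' Qk₂' : F →ₗ[𝕜] S) (Hk₁ Hk₂ Gk₁ Gk₂ : S →ₗ[𝕜] S)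
  (ck₁ ck₂ : F →ₗ[𝕜] F)
  (ha : 0 ≤ a) (hγ : 0 < γ) (hγ1 : γ ≤ 1) (hCQ : 0 ≤ CQ) (hβ : 0 ≤ β) (hβ1 : β ≤ 1)
  (coercive₁ : ∀ f, γ * ‖f‖ ^ 2 ≤ ‖D₁ f‖ ^ 2 + a * ‖Q₁ f‖ ^ 2) (coercive₂ : ∀ f, γ * ‖f‖ ^ 2 ≤ ‖D₂ f‖ ^ 2 + a * ‖Q₂ f‖ ^ 2)
  (hQ₁ : ∀ s, ‖Q₁ s‖ ≤ CQ * ‖s‖) (hQ₂ : ∀ s, ‖Q₂ s‖ ≤ CQ * ‖s‖)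
  (dD₁ : ∀ s, ‖Dk₁ s - D₁ s‖ ≤ β * ‖s‖) (dD₁' : ∀ e, ‖Dk₁' e - LinearMap.adjoint D₁ e‖ ≤ β * ‖e‖)
  (dQ₁ : ∀ s, ‖Qk₁ s - Q₁ s‖ ≤ β * ‖s‖) (dQ₁' : ∀ g, ‖Qk₁' g - LinearMap.adjoint Q₁ g‖ ≤ β * ‖g‖)
  (dD₂ : ∀ s, ‖Dk₂ s - D₂ s‖ ≤ β * ‖s‖) (dD₂' : ∀ e, ‖Dk₂' e - LinearMap.adjoint D₂ e‖ ≤ β * ‖e‖)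
  (dQ₂ : ∀ s, ‖Qk₂ s - Q₂ s‖ ≤ β * ‖s‖) (dQ₂' : ∀ g, ‖Qk₂' g - LinearMap.adjoint Q₂ g‖ ≤ β * ‖g‖)
  (small : 3 * (1 + a) * β ^ 2 ≤ γ / 4)
  (hHk₁ : ∀ f, Hk₁ f = Dk₁' (Dk₁ f) + ((a : ℝ) : 𝕜) • Qk₁' (Qk₁ f)) (hHkGk₁ : ∀ v, Hk₁ (Gk₁ v) = v)
  (hHk₂ : ∀ f, Hk₂ f = Dk₂' (Dk₂ f) + ((a : ℝ) : 𝕜) • Qk₂' (Qk₂ f)) (hHkGk₂ : ∀ v, Hk₂ (Gk₂ v) = v) (hGkHk₂ : ∀ s, Gk₂ (Hk₂ s) = s)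
  {bD bD' bQ bQ' : ℝ} (hbD : 0 ≤ bD) (hbD' : 0 ≤ bD') (hbQ : 0 ≤ bQ) (hbQ' : 0 ≤ bQ')
  (tD : ∀ s, ‖Dk₂ s - Dk₁ s‖ ≤ bD * ‖s‖) (tD' : ∀ e, ‖Dk₂' e - Dk₁' e‖ ≤ bD' * ‖e‖)
  (tQ : ∀ s, ‖Qk₂ s - Qk₁ s‖ ≤ bQ * ‖s‖) (tQ' : ∀ g, ‖Qk₂' g - Qk₁' g‖ ≤ bQ' * ‖g‖)
  -- the conjugated Gram data: `c_{κ,i}` inverts `X_{κ,i} = Q_{κ,i}G_{κ,i}²Q′_{κ,i}` (right at `1`, left at `2`) and is bounded by `C_c`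
  (hXck₁ : ∀ v, Qk₁ (Gk₁ (Gk₁ (Qk₁' (ck₁ v)))) = v) (hckX₂ : ∀ h, ck₂ (Qk₂ (Gk₂ (Gk₂ (Qk₂' h)))) = h)
  {Cc : ℝ} (hCc : 0 ≤ Cc) (nck₁ : ∀ v, ‖ck₁ v‖ ≤ Cc * ‖v‖) (nck₂ : ∀ v, ‖ck₂ v‖ ≤ Cc * ‖v‖)

include ha hγ hγ1 hCQ hβ hβ1 coercive₁ coercive₂ hQ₁ hQ₂ dD₁ dD₁' dQ₁ dQ₁' dD₂ dD₂' dQ₂ dQ₂' small hHk₁ hHkGk₁ hHk₂ hHkGk₂ hGkHk₂ hbD hbD' hbQ hbQ'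
  tD tD' tQ tQ' hXck₁ hckX₂ hCc nck₁ nck₂ in
/-- **THE CONJUGATED PROJECTION WORD AT TWO BACKGROUNDS**: with `n = (4∕γ)(C_Q + 1)` (`‖G_{κ,1}Q′_{κ,1}‖, ‖Q_{κ,2}G_{κ,2}‖ ≤ n`) and
`σ = (4∕γ)b_{Q′} + b_Q(4∕γ) + 2(C_Q + 1)(4∕γ)²(2b_{D′} + (1+β)b_D + a(C_Q+1)(b_Q + b_{Q′}))` (a common bound of I-9's two seams),
`‖G_{κ,2}(Q′_{κ,2}(c_{κ,2}(Q_{κ,2}(G_{κ,2}x)))) − G_{κ,1}(Q′_{κ,1}(c_{κ,1}(Q_{κ,1}(G_{κ,1}x))))‖ ≤ (σC_cn + n·(C_c(σn + nσ)C_c)·n + nC_cσ)·‖x‖` — for `R_κ = 1 − P_κ`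
this is the conjugated two-background letter `δ_R` of the `R`-slot, LINEAR in `b_D, b_{D′}, b_Q, b_{Q′}`. [folklore]
[cite: Balaban1985BackgroundPropagators, (3.21) p.394, (3.25) p.394, (3.49) p.399, Thm 3.11 p.416] -/
theorem norm_Pk_sub_Pk_le (x : S) :
    ‖Gk₂ (Qk₂' (ck₂ (Qk₂ (Gk₂ x)))) - Gk₁ (Qk₁' (ck₁ (Qk₁ (Gk₁ x))))‖ ≤
      ((4 / γ * bQ' + bQ * (4 / γ) + 2 * (CQ + 1) * ((4 / γ) ^ 2 * (2 * bD' + (1 + β) * bD + a * (CQ + 1) * (bQ + bQ')))) * Cc *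
            (4 / γ * (CQ + 1)) +
          4 / γ * (CQ + 1) * (Cc * ((4 / γ * bQ' + bQ * (4 / γ) + 2 * (CQ + 1) * ((4 / γ) ^ 2 * (2 * bD' + (1 + β) * bD + a * (CQ + 1) * (bQ + bQ')))) *
              (4 / γ * (CQ + 1)) + 4 / γ * (CQ + 1) *
              (4 / γ * bQ' + bQ * (4 / γ) + 2 * (CQ + 1) * ((4 / γ) ^ 2 * (2 * bD' + (1 + β) * bD + a * (CQ + 1) * (bQ + bQ'))))) * Cc) *
            (4 / γ * (CQ + 1)) +
        4 / γ * (CQ + 1) * Cc *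
          (4 / γ * bQ' + bQ * (4 / γ) + 2 * (CQ + 1) * ((4 / γ) ^ 2 * (2 * bD' + (1 + β) * bD + a * (CQ + 1) * (bQ + bQ'))))) * ‖x‖ := by
  -- the sizes `n` of `A_{κ,1} = G_{κ,1}Q′_{κ,1}` and `B_{κ,2} = Q_{κ,2}G_{κ,2}`
  have hc0 : (0 : ℝ) ≤ 4 / γ := by positivity
  have nA₁ : ∀ h, ‖(Gk₁ ∘ₗ Qk₁') h‖ ≤ 4 / γ * (CQ + 1) * ‖h‖ := fun h => by
    rw [LinearMap.comp_apply]
    calc ‖Gk₁ (Qk₁' h)‖ ≤ 4 / γ * ‖Qk₁' h‖ :=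
          norm_Gk_le D₁ Q₁ a γ β Dk₁ Dk₁' Qk₁ Qk₁' Hk₁ Gk₁ ha hγ hβ coercive₁ dD₁ dD₁' dQ₁ dQ₁' small hHk₁ hHkGk₁ _
      _ ≤ 4 / γ * ((CQ + 1) * ‖h‖) := mul_le_mul_of_nonneg_left (norm_Qk'_le Q₁ CQ β Qk₁' hCQ hβ1 hQ₁ dQ₁' h) hc0
      _ = _ := by ring
  have nB₂ : ∀ y, ‖(Qk₂ ∘ₗ Gk₂) y‖ ≤ 4 / γ * (CQ + 1) * ‖y‖ := fun y => by
    rw [LinearMap.comp_apply]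
    calc ‖Qk₂ (Gk₂ y)‖ ≤ (CQ + 1) * ‖Gk₂ y‖ := norm_Qk_le Q₂ CQ β Qk₂ hβ1 hQ₂ dQ₂ _
      _ ≤ (CQ + 1) * (4 / γ * ‖y‖) := mul_le_mul_of_nonneg_left
          (norm_Gk_le D₂ Q₂ a γ β Dk₂ Dk₂' Qk₂ Qk₂' Hk₂ Gk₂ ha hγ hβ coercive₂ dD₂ dD₂' dQ₂ dQ₂' small hHk₂ hHkGk₂ y) (by linarith)
      _ = _ := by ring
  -- the two seams of I-9, both dominated by `σ`
  have hG0 : 0 ≤ (4 / γ) ^ 2 * (2 * bD' + (1 + β) * bD + a * (CQ + 1) * (bQ + bQ')) := by positivity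
  have dA : ∀ h, ‖(Gk₂ ∘ₗ Qk₂') h - (Gk₁ ∘ₗ Qk₁') h‖ ≤
      (4 / γ * bQ' + bQ * (4 / γ) + 2 * (CQ + 1) * ((4 / γ) ^ 2 * (2 * bD' + (1 + β) * bD + a * (CQ + 1) * (bQ + bQ')))) * ‖h‖ := fun h => by
    rw [LinearMap.comp_apply, LinearMap.comp_apply]
    refine (norm_Gk_Qk'_sub_Gk_Qk'_le D₁ D₂ Q₁ Q₂ a γ CQ β Dk₁ Dk₂ Dk₁' Dk₂' Qk₁ Qk₂ Qk₁' Qk₂' Hk₁ Hk₂ Gk₁ Gk₂ ha hγ hγ1 hCQ hβ hβ1 coercive₁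
      coercive₂ hQ₁ hQ₂ dD₁ dD₁' dQ₁ dQ₁' dD₂ dD₂' dQ₂ dQ₂' small hHk₁ hHkGk₁ hHk₂ hHkGk₂ hGkHk₂ hbD hbD' hbQ hbQ' tD tD' tQ tQ' h).trans
      (mul_le_mul_of_nonneg_right ?_ (norm_nonneg _))
    nlinarith [hG0, hCQ, hbQ, hc0]
  have dB : ∀ y, ‖(Qk₂ ∘ₗ Gk₂) y - (Qk₁ ∘ₗ Gk₁) y‖ ≤
      (4 / γ * bQ' + bQ * (4 / γ) + 2 * (CQ + 1) * ((4 / γ) ^ 2 * (2 * bD' + (1 + β) * bD + a * (CQ + 1) * (bQ + bQ')))) * ‖y‖ := fun y => by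
    rw [LinearMap.comp_apply, LinearMap.comp_apply]
    refine (norm_Qk_Gk_sub_Qk_Gk_le D₁ D₂ Q₁ Q₂ a γ CQ β Dk₁ Dk₂ Dk₁' Dk₂' Qk₁ Qk₂ Qk₁' Qk₂' Hk₁ Hk₂ Gk₁ Gk₂ ha hγ hγ1 hCQ hβ hβ1 coercive₁
      coercive₂ hQ₁ hQ₂ dD₁ dD₁' dQ₁ dQ₁' dD₂ dD₂' dQ₂ dQ₂' small hHk₁ hHkGk₁ hHk₂ hHkGk₂ hGkHk₂ hbD hbD' hbQ hbQ' tD tD' tQ tQ' y).trans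
      (mul_le_mul_of_nonneg_right ?_ (norm_nonneg _))
    nlinarith [hG0, hCQ, hbQ', hc0]
  have hσ : 0 ≤ 4 / γ * bQ' + bQ * (4 / γ) + 2 * (CQ + 1) * ((4 / γ) ^ 2 * (2 * bD' + (1 + β) * bD + a * (CQ + 1) * (bQ + bQ'))) := by
    positivity
  have key := norm_word_sub_word_le (𝕜 := 𝕜) (Gk₁ ∘ₗ Qk₁') (Gk₂ ∘ₗ Qk₂') (Qk₁ ∘ₗ Gk₁) (Qk₂ ∘ₗ Gk₂) ck₁ ck₂ (by positivity) (by positivity) hCc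
    hσ hσ nA₁ nB₂ nck₁ nck₂ dA dB (fun v => by rw [LinearMap.comp_apply, LinearMap.comp_apply, hXck₁])
    (fun h => by rw [LinearMap.comp_apply, LinearMap.comp_apply, hckX₂]) x
  simpa only [LinearMap.comp_apply] using key

end Families

end Literature.MathematicalPhysics.QuantumFieldTheory.Balaban1983to89.B9Eq349ConjugatedProjectionDifferenceLettersTwoBackgrounds
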